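import Literature.NumberTheory.LFunctions.DegreeOnePrimesPNT
import HarnessLib

/-!
# `π_K(x) ≤ ∑_{p ≤ x} c_K(p) + [K:ℚ] π(√x)`: prime ideals of non-prime norm are few

Topic `Literature/NumberTheory/LFunctions` (namespace `Literature.NumberTheory.LFunctions.NumberField`,
next to `PrimeIdealChebyshev.lean` / `DegreeOnePrimesPNT.lean`, whose `normPrimeIdealCount K n = G(n)`,
`primeIdealCount_eq_sum_normPrimeIdealCount` (`π_K(x) = ∑_{n ≤ x} G(n)`), `normPrimeIdealCount_prime`
(`G(p) = c_K(p)`) and `normPrimeIdealCount_eq_zero_of_not_isPrimePow` this file combines).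
Counting brick of the reduction of Bürgisser 2000 TCS, Cor. 4.8
(`Literature/Computability/AlgebraicComplexity/BurgisserReductionModPrimes.lean`,
`rootModPrimeCount_lower_bound_of_GRH`) to the effective prime ideal theorem under GRH: the
passage from the prime-ideal count `π_K(x)` to the degree-one count `∑_{p ≤ x} c_K(p)`,
`c_K(p) = #{𝔭 : N𝔭 = p}` (Bürgisser, p. 83: "A prime ideal of `K` having norm `≤ x` and degree
`> 1` lies over a rational prime `p ≤ x^{1/2}`. Hence there are at most `d x^{1/2}` such primes of
`K`."). Everything here is PROVED, for every number field `K` and natural `x`: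

* `idealNormCount_prime_le_finrank` — `c_K(p) ≤ [K:ℚ]` (ideals of norm `p` are primes above `p`);
* `mem_primesOver_of_absNorm_eq_pow` — a prime ideal of norm `q^k` lies above `q`;
* `sum_normPrimeIdealCount_not_prime_le` — `∑_{n ≤ x, n not prime} G(n) ≤ [K:ℚ] π(√x)` (such `n`
  with `G(n) ≠ 0` are prime powers `q^k`, `k ≥ 2`, `q ≤ √x`, and the prime ideals of `q`-power
  norm are among the `≤ [K:ℚ]` primes above `q`);
* `primeIdealCount_le_sum_idealNormCount_add` — `π_K(x) ≤ ∑_{p ≤ x} c_K(p) + [K:ℚ] π(√x)`;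
* `primeCounting_le_primeIdealCount_rat` — `π(x) ≤ π_ℚ(x)` (`c_ℚ(p) = 1`).

## References

* P. Bürgisser, *Cook's versus Valiant's hypothesis*, TCS 235 (2000), §4.2 p. 83 (`Burgisser2000TCS`).
-/

noncomputable section

open scoped NumberField
open Finset

namespace Literature.NumberTheory.LFunctions.NumberField

variable (K : Type*) [Field K] [NumberField K]

/-- **At most `[K:ℚ]` ideals of prime norm `p`**: an ideal of norm `p` is a prime ideal above `p`
(`DegreeOnePrimes.absNorm_eq_prime_iff`), and there are at most `[K:ℚ]` of those
(`card_primesOver_le`). [folklore] -/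
theorem idealNormCount_prime_le_finrank {p : ℕ} (hp : p.Prime) :
    idealNormCount K p ≤ Module.finrank ℚ K := by
  haveI := Fact.mk hp
  refine le_trans ?_ (IdealNormCount.card_primesOver_le K hp)
  rw [idealNormCount_def]
  exact Nat.card_le_card_of_injective
    (fun I => ⟨I.1, ((DegreeOnePrimes.absNorm_eq_prime_iff I.1).mp I.2).1⟩)
    (fun I J h => Subtype.ext (by simpa using congrArg Subtype.val h))

variable {K} in
/-- A nonzero prime ideal whose norm is a power of the rational prime `q` lies above `q`.
[folklore] -/
theorem mem_primesOver_of_absNorm_eq_pow {P : Ideal (𝓞 K)} (hP : P.IsPrime) {q k : ℕ}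
    (hq : q.Prime) (hk : Ideal.absNorm P = q ^ k) :
    P ∈ (Ideal.span {(q : ℤ)}).primesOver (𝓞 K) := by
  haveI := Fact.mk hq
  have hqP : (q : 𝓞 K) ∈ P := by
    have h := Ideal.absNorm_mem P
    rw [hk, Nat.cast_pow] at h
    exact hP.mem_of_pow_mem k h
  refine ⟨hP, ⟨?_⟩⟩
  refine Ideal.IsMaximal.eq_of_le inferInstance ?_ ?_
  · rw [Ideal.under_def]
    exact Ideal.comap_ne_top _ hP.ne_top
  · rw [Ideal.span_le, Set.singleton_subset_iff, SetLike.mem_coe, Ideal.under_def, Ideal.mem_comap,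
      map_natCast]
    exact hqP

/-- **The prime ideals of non-prime norm `≤ x` are few**: `∑_{n ≤ x, n not prime} G(n) ≤ [K:ℚ] π(√x)`
— such an `n` with `G(n) ≠ 0` is a prime power `q^k`, `k ≥ 2`, so `q ≤ √x`, and the prime ideals
of norm a power of `q` are among the `≤ [K:ℚ]` primes above `q` (Bürgisser 2000 TCS, p. 83: "A prime
ideal of `K` having norm `≤ x` and degree `> 1` lies over a rational prime `p ≤ x^{1/2}`. Hence there
are at most `d x^{1/2}` such primes of `K`"). [cite: Burgisser2000TCS, §4.2 p. 83] -/
theorem sum_normPrimeIdealCount_not_prime_le (x : ℕ) :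
    ∑ n ∈ (Icc 0 x).filter (fun n => ¬ n.Prime), normPrimeIdealCount K n ≤
      Module.finrank ℚ K * Nat.primeCounting (Nat.sqrt x) := by
  classical
  obtain ⟨S, hS⟩ : ∃ S, S = (Icc 0 x).filter (fun n => ¬ n.Prime) := ⟨_, rfl⟩
  obtain ⟨T, hT⟩ : ∃ T, T = S.filter IsPrimePow := ⟨_, rfl⟩
  rw [← hS]
  -- only prime powers contribute
  have h1 : ∑ n ∈ S, normPrimeIdealCount K n = ∑ n ∈ T, normPrimeIdealCount K n := by
    rw [hT, sum_filter]
    refine sum_congr rfl fun n _ => ?_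
    split_ifs with h
    · rfl
    · exact normPrimeIdealCount_eq_zero_of_not_isPrimePow K h
  have hTmem : ∀ n ∈ T, ¬ n.Prime ∧ IsPrimePow n ∧ n ≤ x := by
    intro n hn
    simp only [hT, hS, mem_filter, mem_Icc] at hn
    exact ⟨hn.1.2, hn.2, hn.1.1.2⟩
  -- group by the prime below
  have hmaps : ∀ n ∈ T, n.minFac ∈ (range (Nat.sqrt x + 1)).filter Nat.Prime := by
    intro n hn
    obtain ⟨hnp, hpp, hnx⟩ := hTmem n hn
    have hn1 : n ≠ 1 := fun h => by rw [h] at hpp; exact not_isPrimePow_one hpp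
    have hn0 : 0 < n := hpp.pos
    rw [mem_filter, mem_range, Nat.lt_succ_iff]
    refine ⟨le_trans (Nat.le_sqrt'.mpr (Nat.minFac_sq_le_self hn0 hnp)) (Nat.sqrt_le_sqrt hnx),
      Nat.minFac_prime hn1⟩
  rw [h1, ← sum_fiberwise_of_maps_to hmaps]
  have hcard : ((range (Nat.sqrt x + 1)).filter Nat.Prime).card = Nat.primeCounting (Nat.sqrt x) := by
    rw [Nat.primeCounting, Nat.primeCounting', Nat.count_eq_card_filter_range]
  rw [← hcard, mul_comm, card_eq_sum_ones, sum_mul, one_mul]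
  refine sum_le_sum fun q hq => ?_
  have hqp : q.Prime := (mem_filter.mp hq).2
  haveI := Fact.mk hqp
  haveI : (Ideal.span {(q : ℤ)}).IsMaximal := Int.ideal_span_isMaximal_of_prime q
  have hq0 : Ideal.span {(q : ℤ)} ≠ ⊥ := by simp [hqp.ne_zero]
  -- the fibre over `q`: every counted prime ideal lies above `q`
  set PO := IsDedekindDomain.primesOverFinset (Ideal.span {(q : ℤ)}) (𝓞 K) with hPO
  have hle : ∀ n ∈ T.filter (fun n => n.minFac = q),
      normPrimeIdealCount K n ≤ (PO.filter fun P => Ideal.absNorm P = n).card := by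
    intro n hn
    rw [mem_filter] at hn
    obtain ⟨hnT, hnq⟩ := hn
    obtain ⟨-, hpp, -⟩ := hTmem n hnT
    obtain ⟨q', k, hq', hk, rfl⟩ := (isPrimePow_nat_iff _).mp hpp
    have hqq : q' = q := by rw [← hnq, Nat.Prime.pow_minFac hq' hk.ne']
    subst hqq
    rw [normPrimeIdealCount, ← Set.ncard_coe_finset]
    refine Set.ncard_le_ncard (fun P hP => ?_) (Finset.finite_toSet _)
    obtain ⟨hP1, -, hP3⟩ := hP
    rw [coe_filter, Set.mem_setOf_eq, hPO, IsDedekindDomain.mem_primesOverFinset_iff hq0]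
    exact ⟨mem_primesOver_of_absNorm_eq_pow hP1 hqp hP3, hP3⟩
  calc ∑ n ∈ T.filter (fun n => n.minFac = q), normPrimeIdealCount K n
      ≤ ∑ n ∈ T.filter (fun n => n.minFac = q), (PO.filter fun P => Ideal.absNorm P = n).card :=
        sum_le_sum hle
    _ = (PO.filter fun P => Ideal.absNorm P ∈ T.filter (fun n => n.minFac = q)).card :=
        sum_card_fiberwise_eq_card_filter _ _ _
    _ ≤ PO.card := card_filter_le _ _
    _ ≤ Module.finrank ℚ K := Ideal.card_primesOverFinset_le_finrank (𝓞 K) ℚ K hq0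

/-- **`π_K(x) ≤ ∑_{p ≤ x} c_K(p) + [K:ℚ] π(√x)`** for natural `x`: the prime ideals of norm `≤ x`
are those of prime norm (`c_K(p)` of them above each `p ≤ x`) and those of prime-power, non-prime
norm (at most `[K:ℚ] π(√x)`, `sum_normPrimeIdealCount_not_prime_le`). [folklore] -/
theorem primeIdealCount_le_sum_idealNormCount_add (x : ℕ) :
    primeIdealCount K x ≤ ∑ p ∈ (range (x + 1)).filter Nat.Prime, idealNormCount K p +
      Module.finrank ℚ K * Nat.primeCounting (Nat.sqrt x) := by
  classical
  have hx : (0 : ℝ) ≤ x := Nat.cast_nonneg x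
  rw [primeIdealCount_eq_sum_normPrimeIdealCount K hx, Nat.floor_natCast,
    ← sum_filter_add_sum_filter_not (Icc 0 x) Nat.Prime]
  refine add_le_add (le_of_eq ?_) (sum_normPrimeIdealCount_not_prime_le K x)
  have hset : (Icc 0 x).filter Nat.Prime = (range (x + 1)).filter Nat.Prime := by
    ext p
    simp
  rw [hset]
  exact sum_congr rfl fun p hp => normPrimeIdealCount_prime K (mem_filter.mp hp).2

/-- **`π(x) ≤ π_ℚ(x)`**: above each rational prime `p` there is exactly one ideal `(p)` of `𝓞 ℚ` of
norm `p` (`idealNormCount_rat`). [folklore] -/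
theorem primeCounting_le_primeIdealCount_rat (x : ℕ) :
    Nat.primeCounting x ≤ primeIdealCount ℚ x := by
  classical
  have hx : (0 : ℝ) ≤ x := Nat.cast_nonneg x
  rw [primeIdealCount_eq_sum_normPrimeIdealCount ℚ hx, Nat.floor_natCast,
    ← sum_filter_add_sum_filter_not (Icc 0 x) Nat.Prime, Nat.primeCounting, Nat.primeCounting',
    Nat.count_eq_card_filter_range, card_eq_sum_ones]
  refine le_trans (le_of_eq ?_) (Nat.le_add_right _ _)
  have hset : (range (x + 1)).filter Nat.Prime = (Icc 0 x).filter Nat.Prime := by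
    ext p
    simp
  rw [hset]
  refine sum_congr rfl fun p hp => ?_
  rw [normPrimeIdealCount_prime ℚ (mem_filter.mp hp).2, idealNormCount_rat]

end Literature.NumberTheory.LFunctions.NumberField
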